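/-
search for candidate a priori estimates; no regularity claim

# K79 — (R25) THE CROSSING-INTERIOR LAWS: the biaxial polynomial identity, director-free

Node of record (verbatim, unchanged): L-λ(q) =
`Summit.NavierStokesRegularity.FunctionalMining.TopEigHeatCoercivePos q := ∃ c > 0,`
`TopEigHeatCoercive q c` — OPEN for every real `q > 1`; (F2) killing family WANTED/OPEN. This
file proves NECESSARY CONDITIONS at INTERIOR CROSSING POINTS (`λ₂ = λ₁` near `x`) of a smooth
divergence-free field on `T³` with a frozen top `λ₁ ≡ m` — in particular of an exact (F2)
witness (`heatDissipation Φ_q v ≤ 0`, `Φ_q v > 0`; `λ₁ ≡ m > 0` by K57b); it constructs none,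
excludes none and decides no node.

THE ONE IDENTITY. Near such a point the spectrum of `S(y)` is `{m, m, −2m}` (trace zero), so
(BI) `S(y)² + m S(y) = 2m²·1` (the director `n` is never named). Differentiating (BI) at `x`
(`Sₖ := S(∂ₖv)(x)`, `Sⱼₖ := S(∂ⱼ∂ₖv)(x)`): (D1) `Sₖ S + S Sₖ + m Sₖ = 0`, (D2) `Sⱼₖ S + Sₖ Sⱼ +
Sⱼ Sₖ + S Sⱼₖ + m Sⱼₖ = 0`. LAWS at `x` for top vectors `S e = m e`, `S f = m f` (§ 4; § 5 exact):
(R25a) BOTTOM LAW `S (Sₖ e) = −2m (Sₖ e)` (`mulVec_mulVec_strainDeriv_eq`); (R25d) CROSS LAW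
`fᵀ Sₖ e = 0` for ANY two top vectors (`dot_strainDeriv_eq_zero`; `f = e` is K78 (R24a), here
with no maximality used); (R25b) GRAM LAW `3m · eᵀ Sⱼₖ e = −2 (Sⱼ e)·(Sₖ e)` (`gram_law`),
summed (R25b′) `3m · eᵀ S(Δv) e = −2 Σₖ |Sₖ e|²` (`laplacian_law`; `eᵀ S(Δv) e ≤ 0` is KINEMATIC
here, K47 used a `λ₁`-max); (R25c) VECTOR LAW: a top `e` with `eᵀ S(Δv) e = 0` — K78 (R24d/e)
supplies one at EVERY point of an exact witness — is killed by the strain of every derivative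
field: `Sₖ e = 0`, `k = 1, 2, 3` (`strainDeriv_mulVec_eq_zero`; the interior-crossing twin of
K77 (R23a), which needs a simple point).
HONEST PLACEMENT: in director coordinates (R25a/b/d) are one-line calculus on `m(1 − 3(n·e)²)`;
the point is the director-free typing. Scope: interior crossing points only (a generic crossing
set has empty interior). Geometric reading (`rank dn(x) ≤ 1`) and THEOREM R (`BiaxialTwistFree`):
K79-NOTE § 4. No number of record moves. [ours; § 1 folklore]
FILING (prove seat g33, REQUEST #109 v2): declarations byte-identical to the no-go seat's staged `TopEigHeatCrossingInterior.STAGING.lean` b741e40d586a97ff (v2, notation-free restage per LEAD (59k)); this line is the only addition.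
-/
import Summits.NavierStokesRegularity.FunctionalMining.TopEigSimpleGap
import Summits.NavierStokesRegularity.FunctionalMining.StrainBlockTilt
import Summits.NavierStokesRegularity.FunctionalMining.TopEigDensityIdentity
import Summits.NavierStokesRegularity.FunctionalMining.TopEigDanskin
import Summits.NavierStokesRegularity.FunctionalMining.NoGo.TopEigHeatIsoTopLow
import HarnessLib

noncomputable section

open Filter Topology Set Matrix

namespace Summit.NavierStokesRegularity.FunctionalMining

open Literature.Analysis Literature.Analysis.FunctionSpaces Literature.Analysis.FunctionSpaces.Torus
  Literature.Analysis.FluidPDE StrainL4 SharpClass.DirectorForm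

namespace TopEig.CrossInt

/-! ## 1. A Hermitian matrix with spectrum in `{a, b}` satisfies `(A − a)(A − b) = 0` -/

/-- **`(A − a·1)(A − b·1) = 0`** for a real Hermitian matrix with all eigenvalues in `{a, b}`
(spectral theorem; converse of BH 2.11.1 `…TwoEigenvalueBlocks.eigenvalues_eq_or_eq`). [folklore] -/
theorem mul_eq_zero_of_eigenvalues_mem {n : Type*} [Fintype n] [DecidableEq n] {A : Matrix n n ℝ}
    (hA : A.IsHermitian) {a b : ℝ} (h : ∀ i, hA.eigenvalues i = a ∨ hA.eigenvalues i = b) :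
    (A - a • (1 : Matrix n n ℝ)) * (A - b • (1 : Matrix n n ℝ)) = 0 := by
  set φ := Unitary.conjStarAlgAut ℝ (Matrix n n ℝ) hA.eigenvectorUnitary
  have hD : (diagonal (RCLike.ofReal ∘ hA.eigenvalues : n → ℝ) - a • (1 : Matrix n n ℝ)) *
      (diagonal (RCLike.ofReal ∘ hA.eigenvalues : n → ℝ) - b • (1 : Matrix n n ℝ)) = 0 := by
    rw [smul_one_eq_diagonal, smul_one_eq_diagonal, diagonal_sub, diagonal_sub,
      diagonal_mul_diagonal, ← diagonal_zero]
    refine congrArg diagonal (funext fun i => ?_)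
    rcases h i with hi | hi <;> simp [hi]
  have hspec : A = φ (diagonal (RCLike.ofReal ∘ hA.eigenvalues : n → ℝ)) := hA.spectral_theorem
  have hAB : (A - a • (1 : Matrix n n ℝ)) * (A - b • (1 : Matrix n n ℝ)) =
      φ ((diagonal (RCLike.ofReal ∘ hA.eigenvalues : n → ℝ) - a • (1 : Matrix n n ℝ)) *
        (diagonal (RCLike.ofReal ∘ hA.eigenvalues : n → ℝ) - b • (1 : Matrix n n ℝ))) := by
    rw [map_mul, map_sub, map_sub, map_smul, map_smul, map_one, ← hspec]
  rw [hAB, hD, map_zero]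

/-! ## 2. `T³`: at a biaxial point `λ₂ = λ₁ = m` the spectrum is `{m, −2m}` and (BI) holds -/

section Biaxial

variable {v : UnitAddTorus (Fin 3) → EuclideanSpace ℝ (Fin 3)} (hv : Torus.IsSmooth v)
  (hdv : Torus.IsDivFree v) {y : UnitAddTorus (Fin 3)} {m : ℝ}
include hv hdv

/-- At a point with `λ₂(y) = λ₁(y) = m` of a smooth divergence-free field on `T³` every
eigenvalue of `S(y)` is `m` or `−2m` (`λ₁ = λ₂ = m`, `λ₃ = −λ₁ − λ₂`). [ours, bookkeeping] -/
theorem strainEigenvalues_eq_or_eq (htop : torusStrainTopEig v y = m)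
    (hmid : torusStrainMidEig v y = m) (i : Fin 3) :
    (torusStrainMatrix_isHermitian v y).eigenvalues i = m ∨
      (torusStrainMatrix_isHermitian v y).eigenvalues i = -2 * m := by
  have hd : Fintype.card (Fin 3) = 3 := Fintype.card_fin 3
  set e := torusStrainEig v y with he
  set k := (Fintype.equivOfCardEq (Fintype.card_fin _)).symm i
  set f : Fin 3 → ℝ := fun j => e (Fin.cast hd.symm j)
  obtain ⟨h0, h1⟩ := torusStrainMidEig_eq_eig_one v y
  have hf0 : f 0 = m := by rw [← htop, h0]; exact congrArg e (Fin.ext rfl)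
  have hf1 : f 1 = m := by rw [← hmid, h1]; exact congrArg e (Fin.ext rfl)
  have hsum : ∑ j, f j = ∑ k', e k' := Fintype.sum_equiv (finCongr hd.symm) f e (fun j => rfl)
  have hf2 : f 2 = -2 * m := by
    have h3 : f 0 + f 1 + f 2 = 0 := by
      rw [← Fin.sum_univ_three, hsum, he]; exact sum_torusStrainEig_eq_zero hv hdv y
    linarith
  have hkf : (torusStrainMatrix_isHermitian v y).eigenvalues i = f (Fin.cast hd k) :=
    congrArg e (Fin.ext rfl)
  rw [hkf]
  generalize Fin.cast hd k = j
  fin_cases j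
  · exact Or.inl hf0
  · exact Or.inl hf1
  · exact Or.inr hf2

/-- **(BI) `S(y)² + m S(y) = 2m²·1`** at a point with `λ₂(y) = λ₁(y) = m` (div-free). [ours] -/
theorem strain_sq_add_smul_eq (htop : torusStrainTopEig v y = m)
    (hmid : torusStrainMidEig v y = m) :
    torusStrainMatrix v y * torusStrainMatrix v y + m • torusStrainMatrix v y =
      (2 * m ^ 2) • (1 : Matrix (Fin 3) (Fin 3) ℝ) := by
  have h := mul_eq_zero_of_eigenvalues_mem (torusStrainMatrix_isHermitian v y)
    (strainEigenvalues_eq_or_eq hv hdv htop hmid)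
  rw [sub_mul, mul_sub, mul_sub, Matrix.mul_smul, Matrix.mul_one, Matrix.smul_mul,
    Matrix.one_mul, Matrix.smul_mul, Matrix.one_mul, smul_smul] at h
  rw [← sub_eq_zero, ← h]
  module

end Biaxial

/-! ## 3. Differentiating (BI): the product rule for strain entries, (D1) and (D2) -/

section Deriv

variable {d : Type*} [Fintype d] [DecidableEq d] {u w v : UnitAddTorus d → EuclideanSpace ℝ d}

/-- The strain entries of a smooth field are `C¹`. [folklore] -/
theorem isContDiff_strain_entry (hu : Torus.IsSmooth u) (a b : d) :
    Torus.IsContDiff 1 (fun z => torusStrainMatrix u z a b) :=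
  (isSmooth_torusStrainMatrix_entry hu a b).isContDiff (by simp)

/-- The entries of a product of two strains are `C¹`. [folklore] -/
theorem isContDiff_strainMul_entry (hu : Torus.IsSmooth u) (hw : Torus.IsSmooth w) (i j : d) :
    Torus.IsContDiff 1 (fun z => (torusStrainMatrix u z * torusStrainMatrix w z) i j) := by
  change ContDiff ℝ 1 fun p =>
    ∑ l, Torus.lift (fun z => torusStrainMatrix u z i l) p *
      Torus.lift (fun z => torusStrainMatrix w z l j) p
  exact ContDiff.sum fun l _ =>
    (isContDiff_strain_entry hu i l).mul (isContDiff_strain_entry hw l j)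

/-- The entries of `m·S(u)` are `C¹`. [folklore] -/
theorem isContDiff_smul_strain_entry (hu : Torus.IsSmooth u) (m : ℝ) (i j : d) :
    Torus.IsContDiff 1 (fun z => (m • torusStrainMatrix u z) i j) :=
  (isContDiff_strain_entry hu i j).smul m

/-- `∂ₖ (S(u) S(w))ᵢⱼ = (S(∂ₖu) S(w) + S(u) S(∂ₖw))ᵢⱼ` (product rule). [folklore] -/
theorem partialDeriv_strainMul_entry (hu : Torus.IsSmooth u) (hw : Torus.IsSmooth w) (k i j : d)
    (y : UnitAddTorus d) :
    Torus.partialDeriv k (fun z => (torusStrainMatrix u z * torusStrainMatrix w z) i j) y =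
      (torusStrainMatrix (Torus.partialDeriv k u) y * torusStrainMatrix w y +
        torusStrainMatrix u y * torusStrainMatrix (Torus.partialDeriv k w) y) i j := by
  have hfun : (fun z => (torusStrainMatrix u z * torusStrainMatrix w z) i j) =
      fun z => ∑ l ∈ Finset.univ, torusStrainMatrix u z i l * torusStrainMatrix w z l j :=
    funext fun z => Matrix.mul_apply
  rw [hfun, partialDeriv_finset_sum Finset.univ
    (f := fun l z => torusStrainMatrix u z i l * torusStrainMatrix w z l j)
    (fun l _ => (isContDiff_strain_entry hu i l).mul (isContDiff_strain_entry hw l j))]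
  simp only [Matrix.add_apply, Matrix.mul_apply, ← Finset.sum_add_distrib]
  refine Finset.sum_congr rfl fun l _ => ?_
  rw [partialDeriv_mul (isContDiff_strain_entry hu i l) (isContDiff_strain_entry hw l j),
    partialDeriv_strainEntry hu k i l y, partialDeriv_strainEntry hw k l j y]
  ring

/-- `∂ₖ (m·S(u))ᵢⱼ = (m·S(∂ₖu))ᵢⱼ`. [folklore] -/
theorem partialDeriv_smul_strain_entry (hu : Torus.IsSmooth u) (m : ℝ) (k i j : d)
    (y : UnitAddTorus d) : Torus.partialDeriv k (fun z => (m • torusStrainMatrix u z) i j) y =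
      (m • torusStrainMatrix (Torus.partialDeriv k u) y) i j := by
  show Torus.partialDeriv k (m • fun z => torusStrainMatrix u z i j) y = _
  rw [partialDeriv_const_smul (isContDiff_strain_entry hu i j), Pi.smul_apply,
    partialDeriv_strainEntry hu k i j y, Matrix.smul_apply]

/-- A real function constant near `x` has `∂ⱼ = 0` there (locality of the line derivative). -/
theorem partialDeriv_eq_zero_of_eventually_eq {g : UnitAddTorus d → ℝ} {x : UnitAddTorus d}
    {c : ℝ} (h : ∀ᶠ y in 𝓝 x, g y = c) (j : d) : Torus.partialDeriv j g x = 0 := by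
  unfold Torus.partialDeriv Torus.lineDeriv
  have hcont : Continuous fun t : ℝ => x + proj (t • EuclideanSpace.single j (1 : ℝ)) :=
    continuous_const.add (continuous_proj.comp (continuous_id.smul continuous_const))
  have hc := hcont.continuousAt (x := 0)
  rw [ContinuousAt, zero_smul, proj_zero, add_zero] at hc
  rw [Filter.EventuallyEq.deriv_eq (hc.eventually h :
    (fun t : ℝ => g (x + proj (t • EuclideanSpace.single j (1 : ℝ)))) =ᶠ[𝓝 0] fun _ => c)]
  exact deriv_const 0 c

variable {x : UnitAddTorus d} {m c : ℝ} (hv : Torus.IsSmooth v)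
  (hP : ∀ᶠ y in 𝓝 x, torusStrainMatrix v y * torusStrainMatrix v y + m • torusStrainMatrix v y =
    c • (1 : Matrix d d ℝ))
include hv hP

/-- **(D1) near `x`**: (BI) `S² + m S = c·1` near `x` ⟹ `Sₖ S + S Sₖ + m Sₖ = 0` near `x`. [ours] -/
theorem eventually_D1 (k : d) :
    ∀ᶠ y in 𝓝 x, torusStrainMatrix (Torus.partialDeriv k v) y * torusStrainMatrix v y +
      torusStrainMatrix v y * torusStrainMatrix (Torus.partialDeriv k v) y +
      m • torusStrainMatrix (Torus.partialDeriv k v) y = 0 := by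
  filter_upwards [hP.eventually_nhds] with y hy
  ext i j
  have hconst : ∀ᶠ z in 𝓝 y, ((fun z => (torusStrainMatrix v z * torusStrainMatrix v z) i j) +
      fun z => (m • torusStrainMatrix v z) i j) z =
      (c • (1 : Matrix d d ℝ)) i j := by
    filter_upwards [hy] with z hz
    exact congrFun (congrFun hz i) j
  have h0 := partialDeriv_eq_zero_of_eventually_eq hconst k
  rw [partialDeriv_add (isContDiff_strainMul_entry hv hv i j)
    (isContDiff_smul_strain_entry hv m i j), Pi.add_apply,
    partialDeriv_strainMul_entry hv hv k i j y, partialDeriv_smul_strain_entry hv m k i j y] at h0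
  simpa [Matrix.add_apply] using h0

/-- **(D2) at `x`**: `Sⱼₖ S + Sₖ Sⱼ + Sⱼ Sₖ + S Sⱼₖ + m Sⱼₖ = 0` under the same hypothesis. -/
theorem D2_of_eventually (j k : d) :
    torusStrainMatrix (Torus.partialDeriv j (Torus.partialDeriv k v)) x * torusStrainMatrix v x +
      torusStrainMatrix (Torus.partialDeriv k v) x * torusStrainMatrix (Torus.partialDeriv j v) x +
      torusStrainMatrix (Torus.partialDeriv j v) x * torusStrainMatrix (Torus.partialDeriv k v) x +
      torusStrainMatrix v x * torusStrainMatrix (Torus.partialDeriv j (Torus.partialDeriv k v)) x +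
      m • torusStrainMatrix (Torus.partialDeriv j (Torus.partialDeriv k v)) x = 0 := by
  have hvk : Torus.IsSmooth (Torus.partialDeriv k v) := hv.partialDeriv k
  ext i l
  have hconst : ∀ᶠ z in 𝓝 x,
      ((fun z => (torusStrainMatrix (Torus.partialDeriv k v) z * torusStrainMatrix v z) i l) +
      (fun z => (torusStrainMatrix v z * torusStrainMatrix (Torus.partialDeriv k v) z) i l) +
      fun z => (m • torusStrainMatrix (Torus.partialDeriv k v) z) i l) z =
        (0 : Matrix d d ℝ) i l := by
    filter_upwards [eventually_D1 hv hP k] with z hz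
    exact congrFun (congrFun hz i) l
  have h0 := partialDeriv_eq_zero_of_eventually_eq hconst j
  rw [partialDeriv_add ((isContDiff_strainMul_entry hvk hv i l).add
      (isContDiff_strainMul_entry hv hvk i l)) (isContDiff_smul_strain_entry hvk m i l),
    partialDeriv_add (isContDiff_strainMul_entry hvk hv i l)
    (isContDiff_strainMul_entry hv hvk i l)] at h0
  simp only [Pi.add_apply, partialDeriv_strainMul_entry hvk hv j i l x,
    partialDeriv_strainMul_entry hv hvk j i l x, partialDeriv_smul_strain_entry hvk m j i l x,
    Matrix.add_apply] at h0
  simp only [Matrix.add_apply, Matrix.zero_apply]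
  linarith

end Deriv

/-! ## 4. The laws at an interior crossing point, for top vectors `S e = m e` -/

section Laws

variable {d : Type*} [Fintype d] [DecidableEq d] {v : UnitAddTorus d → EuclideanSpace ℝ d}
  {x : UnitAddTorus d} {m c : ℝ} {e f : d → ℝ}

omit [DecidableEq d] in
/-- For a symmetric matrix, `a·(M b) = (M a)·b`. [folklore] -/
theorem dot_mulVec_comm_of_isSymm {M : Matrix d d ℝ} (hM : M.IsSymm) (a b : d → ℝ) :
    a ⬝ᵥ M *ᵥ b = (M *ᵥ a) ⬝ᵥ b := by
  rw [dotProduct_mulVec, ← Matrix.mulVec_transpose, hM.eq]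

variable (hv : Torus.IsSmooth v)
  (hP : ∀ᶠ y in 𝓝 x, torusStrainMatrix v y * torusStrainMatrix v y + m • torusStrainMatrix v y =
    c • (1 : Matrix d d ℝ))
  (he : torusStrainMatrix v x *ᵥ e = m • e)
include hv hP he

/-- **(R25a) BOTTOM LAW `S(x)(Sₖ e) = −2m·(Sₖ e)`**, `Sₖ = S(∂ₖv)(x)`, top `e`, (BI) near `x`. -/
theorem mulVec_mulVec_strainDeriv_eq (k : d) :
    torusStrainMatrix v x *ᵥ (torusStrainMatrix (Torus.partialDeriv k v) x *ᵥ e) =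
      (-(2 * m)) • (torusStrainMatrix (Torus.partialDeriv k v) x *ᵥ e) := by
  have h := congrArg (fun M => M *ᵥ e) ((eventually_D1 hv hP k).self_of_nhds)
  simp only [Matrix.add_mulVec, ← Matrix.mulVec_mulVec, Matrix.smul_mulVec, he,
    Matrix.mulVec_smul, Matrix.zero_mulVec] at h
  funext i
  have hi := congrFun h i
  simp only [Pi.add_apply, Pi.smul_apply, smul_eq_mul, Pi.zero_apply] at hi ⊢
  linarith

/-- **(R25d) CROSS LAW `fᵀ Sₖ e = 0`** (`m ≠ 0`) for ANY two top vectors (`f·`(D1)`e`). [ours] -/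
theorem dot_strainDeriv_eq_zero (hf : torusStrainMatrix v x *ᵥ f = m • f) (hm : m ≠ 0) (k : d) :
    f ⬝ᵥ torusStrainMatrix (Torus.partialDeriv k v) x *ᵥ e = 0 := by
  have h := congrArg (fun M => f ⬝ᵥ M *ᵥ e) ((eventually_D1 hv hP k).self_of_nhds)
  simp only [Matrix.add_mulVec, ← Matrix.mulVec_mulVec, Matrix.smul_mulVec, he,
    Matrix.mulVec_smul, Matrix.zero_mulVec, dotProduct_add, dotProduct_smul, dotProduct_zero,
    smul_eq_mul] at h
  rw [dot_mulVec_comm_of_isSymm (torusStrainMatrix_isSymm v x), hf, smul_dotProduct,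
    smul_eq_mul] at h
  have h3 : 3 * m * (f ⬝ᵥ torusStrainMatrix (Torus.partialDeriv k v) x *ᵥ e) = 0 := by linarith
  rcases mul_eq_zero.mp h3 with h' | h'
  · exact absurd h' (by positivity)
  · exact h'

/-- **(R25b) GRAM LAW `3m · eᵀ Sⱼₖ e = −2 (Sⱼ e)·(Sₖ e)`**, `Sⱼₖ = S(∂ⱼ∂ₖv)(x)` (`e·`(D2)`e`). -/
theorem gram_law (j k : d) :
    3 * m * (e ⬝ᵥ torusStrainMatrix (Torus.partialDeriv j (Torus.partialDeriv k v)) x *ᵥ e) =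
    -2 * ((torusStrainMatrix (Torus.partialDeriv j v) x *ᵥ e) ⬝ᵥ
      (torusStrainMatrix (Torus.partialDeriv k v) x *ᵥ e)) := by
  have h := congrArg (fun M => e ⬝ᵥ M *ᵥ e) (D2_of_eventually hv hP j k)
  simp only [Matrix.add_mulVec, ← Matrix.mulVec_mulVec, Matrix.smul_mulVec, he,
    Matrix.mulVec_smul, Matrix.zero_mulVec, dotProduct_add, dotProduct_smul, dotProduct_zero,
    smul_eq_mul] at h
  rw [dot_mulVec_comm_of_isSymm (torusStrainMatrix_isSymm (Torus.partialDeriv k v) x) e,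
    dot_mulVec_comm_of_isSymm (torusStrainMatrix_isSymm (Torus.partialDeriv j v) x) e,
    dot_mulVec_comm_of_isSymm (torusStrainMatrix_isSymm v x) e, he, smul_dotProduct, smul_eq_mul,
    dotProduct_comm (torusStrainMatrix (Torus.partialDeriv k v) x *ᵥ e)] at h
  linarith

/-- **(R25b′) LAPLACIAN LAW `3m · eᵀ S(Δv)(x) e = −2 Σₖ |Sₖ e|²`** (`S(Δv) = Σₖ Sₖₖ`). [ours] -/
theorem laplacian_law : 3 * m * (e ⬝ᵥ torusStrainMatrix (Torus.laplacian v) x *ᵥ e) =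
    -2 * ∑ k, (torusStrainMatrix (Torus.partialDeriv k v) x *ᵥ e) ⬝ᵥ
      (torusStrainMatrix (Torus.partialDeriv k v) x *ᵥ e) := by
  have hM : torusStrainMatrix (Torus.laplacian v) x =
      ∑ k, torusStrainMatrix (Torus.partialDeriv k (Torus.partialDeriv k v)) x := by
    ext i j
    rw [Matrix.sum_apply, torusStrainMatrix_laplacian hv x i j]
  rw [hM, Matrix.sum_mulVec, dotProduct_sum, Finset.mul_sum, Finset.mul_sum]
  exact Finset.sum_congr rfl fun k _ => gram_law hv hP he k k

/-- **(R25c) VECTOR LAW**: a top vector with `eᵀ S(Δv)(x) e = 0` at an interior crossing point is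
killed by the strain of every `∂ₖv`: `S(∂ₖv)(x) e = 0` (`Σₖ |Sₖ e|² = 0` by (R25b′)). [ours] -/
theorem strainDeriv_mulVec_eq_zero (hflat : e ⬝ᵥ torusStrainMatrix (Torus.laplacian v) x *ᵥ e = 0)
    (k : d) : torusStrainMatrix (Torus.partialDeriv k v) x *ᵥ e = 0 := by
  have h := laplacian_law hv hP he
  rw [hflat, mul_zero] at h
  have hs : ∑ k, (torusStrainMatrix (Torus.partialDeriv k v) x *ᵥ e) ⬝ᵥ
      (torusStrainMatrix (Torus.partialDeriv k v) x *ᵥ e) = 0 := by linarith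
  have hk := (Finset.sum_eq_zero_iff_of_nonneg fun k _ =>
    Finset.sum_nonneg fun i _ => mul_self_nonneg _).mp hs k (Finset.mem_univ k)
  exact dotProduct_self_eq_zero.mp hk

end Laws

/-! ## 5. Exact (F2) witnesses on `T³`: the laws at interior crossing points -/

section Exact

variable {v : UnitAddTorus (Fin 3) → EuclideanSpace ℝ (Fin 3)} {q : ℝ} {x : UnitAddTorus (Fin 3)}
  {e f : Fin 3 → ℝ}

/-- A top Rayleigh vector is a top eigenvector (`mulVec_eq_smul_of_ray_eq_lam1`). [folklore] -/
theorem mulVec_eq_smul_of_mem_topEigSet (he : e ∈ topEigSet (strainFlat v x)) :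
    torusStrainMatrix v x *ᵥ e = torusStrainTopEig v x • e := by
  have hlam : lam1 (torusStrainMatrix v x) = torusStrainTopEig v x := by
    rw [lam1, flat_torusStrainMatrix, lam_strainFlat]
  have htop : e ⬝ᵥ torusStrainMatrix v x *ᵥ e = lam1 (torusStrainMatrix v x) := by
    rw [← quad_flat, lam1, flat_torusStrainMatrix]; exact he.2
  exact hlam ▸ BlockReduction.mulVec_eq_smul_of_ray_eq_lam1 (torusStrainMatrix_isSymm v x) he.1 htop

variable (hq : 1 < q) (hv : Torus.IsSmooth v) (hdv : Torus.IsDivFree v)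
  (hT : heatDissipation (torusTopEigMoment q) v ≤ 0) (hΦ : 0 < torusTopEigMoment q v)
include hq hv hdv hT hΦ

/-- The frozen top of an exact witness is positive: `λ₁ ≡ λ₁(x) > 0` (K57b; `Φ_q = λ₁^q`). [ours] -/
theorem topEig_pos_and_const (y : UnitAddTorus (Fin 3)) :
    0 < torusStrainTopEig v x ∧ torusStrainTopEig v y = torusStrainTopEig v x := by
  have hd : Fintype.card (Fin 3) = 3 := Fintype.card_fin 3
  refine ⟨?_, torusStrainTopEig_eq_of_heatDissipation_nonpos_of_one_lt hd hq hv hdv hT y x⟩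
  have hm0 : 0 ≤ torusStrainTopEig v x := by
    rw [← lam_strainFlat]; exact lam_strainFlat_nonneg hv hdv x
  rcases hm0.lt_or_eq with h | h
  · exact h
  have hΦm := torusTopEigMoment_eq_rpow_of_heatDissipation_nonpos_of_one_lt hd hq hv hdv hT x q
  rw [← h, Real.zero_rpow (by linarith : q ≠ 0)] at hΦm
  exact absurd hΦm hΦ.ne'

/-- **(BI) for exact witnesses**: if `λ₂ = λ₁` near `x`, then `S² + λ₁(x) S = 2λ₁(x)²·1` near `x`
(so every § 4 law holds: `m = λ₁(x) > 0`, `he` from `mulVec_eq_smul_of_mem_topEigSet`). [ours] -/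
theorem eventually_biaxialPoly_of_exact
    (hx : ∀ᶠ y in 𝓝 x, torusStrainMidEig v y = torusStrainTopEig v y) :
    ∀ᶠ y in 𝓝 x, torusStrainMatrix v y * torusStrainMatrix v y +
      torusStrainTopEig v x • torusStrainMatrix v y =
        (2 * torusStrainTopEig v x ^ 2) • (1 : Matrix (Fin 3) (Fin 3) ℝ) := by
  filter_upwards [hx] with y hy
  have hc := (topEig_pos_and_const (x := x) hq hv hdv hT hΦ y).2
  exact strain_sq_add_smul_eq hv hdv hc (hy.trans hc)

/-- **(R25d) for exact witnesses**: `fᵀ S(∂ₖv)(x) e = 0` for any two top vectors at an interior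
crossing point. [ours] -/
theorem cross_law_of_exact (hx : ∀ᶠ y in 𝓝 x, torusStrainMidEig v y = torusStrainTopEig v y)
    (he : e ∈ topEigSet (strainFlat v x)) (hf : f ∈ topEigSet (strainFlat v x)) (k : Fin 3) :
    f ⬝ᵥ torusStrainMatrix (Torus.partialDeriv k v) x *ᵥ e = 0 :=
  dot_strainDeriv_eq_zero hv (eventually_biaxialPoly_of_exact hq hv hdv hT hΦ hx)
    (mulVec_eq_smul_of_mem_topEigSet he) (mulVec_eq_smul_of_mem_topEigSet hf)
    (topEig_pos_and_const hq hv hdv hT hΦ x).1.ne' k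

/-- **(R25c) for exact witnesses**: a top `e` with `quad (S(Δv) x) e = 0` at an interior crossing
point (K78 `FlatTop.exists_flat_topVec_of_exact` gives one everywhere) has `S(∂ₖv)(x) e = 0`. -/
theorem vector_law_of_exact (hx : ∀ᶠ y in 𝓝 x, torusStrainMidEig v y = torusStrainTopEig v y)
    (he : e ∈ topEigSet (strainFlat v x)) (hflat : quad (strainFlat (Torus.laplacian v) x) e = 0)
    (k : Fin 3) : torusStrainMatrix (Torus.partialDeriv k v) x *ᵥ e = 0 :=
  strainDeriv_mulVec_eq_zero hv (eventually_biaxialPoly_of_exact hq hv hdv hT hΦ hx)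
    (mulVec_eq_smul_of_mem_topEigSet he) (by rwa [← flat_torusStrainMatrix, quad_flat] at hflat) k

/-- **(R25c) from `μ(x) = 0`**: if the Danskin mass vanishes at an interior crossing point (K78
`FlatTop.dirTopEig_laplacian_eq_zero_of_exact`: `μ ≡ 0` for exact witnesses), some top vector is
killed by the strain of every derivative field. [ours] -/
theorem exists_topVec_vector_law_of_exact
    (hx : ∀ᶠ y in 𝓝 x, torusStrainMidEig v y = torusStrainTopEig v y)
    (hμ : dirTopEig (strainFlat v x) (strainFlat (Torus.laplacian v) x) = 0) :
    ∃ e ∈ topEigSet (strainFlat v x),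
      ∀ k, torusStrainMatrix (Torus.partialDeriv k v) x *ᵥ e = 0 := by
  obtain ⟨e, he, h⟩ := exists_quad_eq_dirTopEig (strainFlat v x) (strainFlat (Torus.laplacian v) x)
  exact ⟨e, he, vector_law_of_exact hq hv hdv hT hΦ hx he (h.trans hμ)⟩

end Exact

end TopEig.CrossInt

end Summit.NavierStokesRegularity.FunctionalMining

end
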